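import Summits.QuantumFields.YangMills.Theorems.FlatTubeReductionDecimationExact
import HarnessLib

/-!
# Route `FlatTubeReduction`, crux `PinnedUnitStepEx` (stmt-QuantumFields-27561), stub `stub_smearVarPosGS1` — D2: the fine identity (★)

Seat ym-line-fcl-p3 g9 (2026-08-28).  Blueprint file D2 = memo §P3.  For a bounded measurable coarse `g` on `GaugeConfig 3 L' G` whose translation
SMEAR `S g (U) = Σ_v g(thin L' (τ_v U))` (`L' ≤ L ≤ 2L'`) is a.e. CONSTANT on the fine torus, regroup `Σ_v Σ_R g^{=R} ∘ thin ∘ τ_v` (Hoeffding parts,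
`sum_esPart`) by fine support: for every non-empty `F ⊆ Edge 3 L`,
  `h_F := Σ_v Σ_{R : fineSupp L v R = F} g^{=R} ∘ thin L' ∘ τ_v`
depends only on `F` (D1a `dependsOff_comp_thin_shift`) and is exact on `F` (D1b `condAvg_esPart_comp_thin_shift_eq_zero`), and `Σ_F h_F = S g − |Λ|∫g`; the
UNIQUENESS of the Hoeffding decomposition on the fine torus (`Hoeffding.ae_eq_zero_of_sum_parts`) then gives ★ `smearParts_ae_eq_zero`: **every `h_F`
vanishes a.e.**  This is the identity on which the extremal/combinatorial part of the W-inj proof (blueprint D3–D5) operates.  R2b1 RECORD rung; nothing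
here is a summit, a crux or the stub.
-/

set_option autoImplicit false

noncomputable section

namespace Summit.QuantumFields.YangMills.Theorems.FlatTubeReduction.Decimation

open MeasureTheory Finset Function
open Literature.MathematicalPhysics.QuantumFieldTheory (Site Edge GaugeConfig haarProbability)
open Literature.MathematicalPhysics.QuantumFieldTheory.TorusTranslation
open Summit.QuantumFields.YangMills.Theorems.FemtoCutoffLadder.Thinning
open Summit.QuantumFields.YangMills.Theorems.FemtoTransferGap (configMeasure)
open Literature.Probability.Independence.Hoeffding

variable {G : Type*} [Group G] [MeasurableSpace G] {L L' : ℕ} [NeZero L] [NeZero L']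

omit [NeZero L] [NeZero L'] in
/-- The fine support is empty only for the empty coarse set (every thinning path has a first link). [folklore] -/
theorem fineSupp_eq_empty_iff (v : Site 3 L) (R : Finset (Edge 3 L')) : fineSupp L v R = ∅ ↔ R = ∅ := by
  constructor
  · intro h
    by_contra hR
    obtain ⟨e', he'⟩ := Finset.nonempty_iff_ne_empty.2 hR
    have : (thinSite L e'.1 - v, e'.2) ∈ fineSupp L v R := mem_fineSupp.2 ⟨e', he', base_mem_pathLinks v e'⟩
    rw [h] at this
    exact Finset.notMem_empty _ this
  · rintro rfl
    simp [fineSupp]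

variable [TopologicalSpace G] [IsTopologicalGroup G] [CompactSpace G] [BorelSpace G] [SecondCountableTopology G]

omit [CompactSpace G] in
/-- Measurability of the decimation read through a translation. [folklore] -/
theorem measurable_thin_shift (v : Site 3 L) :
    Measurable fun U : GaugeConfig 3 L G => thin L' (torusConfigShift v U) :=
  Measurable.comp (measurable_thin (d := 3) (L := L) (L' := L') (G := G)) (torusConfigShift v).measurable

omit [SecondCountableTopology G] in
/-- The empty part is the constant `∫ g`. [folklore] -/
theorem esPart_empty (g : GaugeConfig 3 L' G → ℝ) :
    esPart (haarProbability G) ∅ g = fun _ => ∫ W, g W ∂(configMeasure G L') := by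
  funext W
  simp only [esPart, Finset.powerset_empty, Finset.sum_singleton, Finset.card_empty, add_zero, pow_zero, one_mul,
    Finset.sdiff_empty]
  rw [condAvg_univ]
  rfl

/-- ★ **The fine identity (★)**: if the smear of a bounded measurable coarse `g` is a.e. constant, then for every non-empty fine link set `F` the
regrouped pulled-back parts `Σ_v Σ_{R : fineSupp L v R = F} g^{=R} ∘ thin L' ∘ τ_v` vanish a.e. (memo §P3). [folklore] -/
theorem smearParts_ae_eq_zero (hLL : L' ≤ L) {g : GaugeConfig 3 L' G → ℝ} (hg : Measurable g) {C : ℝ} (hC : ∀ U', |g U'| ≤ C)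
    {c : ℝ} (hS : (fun U : GaugeConfig 3 L G => ∑ v : Site 3 L, g (thin L' (torusConfigShift v U))) =ᵐ[configMeasure G L] fun _ => c)
    (F : Finset (Edge 3 L)) (hF : F.Nonempty) :
    (fun U : GaugeConfig 3 L G => ∑ v : Site 3 L, ∑ R ∈ univ.filter (fun R : Finset (Edge 3 L') => fineSupp L v R = F),
        esPart (haarProbability G) R g (thin L' (torusConfigShift v U))) =ᵐ[configMeasure G L] 0 := by
  classical
  set η := haarProbability G with hη
  -- the pulled-back parts and their bounds
  let P : Site 3 L → Finset (Edge 3 L') → GaugeConfig 3 L G → ℝ := fun v R U => esPart η R g (thin L' (torusConfigShift v U))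
  have hPm : ∀ v R, Measurable (P v R) := fun v R => (measurable_esPart R hg).comp (measurable_thin_shift v)
  have hPb : ∀ v R U, |P v R U| ≤ 2 ^ Fintype.card (Edge 3 L') * C := fun v R U => by
    refine (abs_esPart_le R hC _).trans ?_
    have hC0 : 0 ≤ C := (abs_nonneg _).trans (hC (thin L' (torusConfigShift v U)))
    exact mul_le_mul_of_nonneg_right (pow_le_pow_right₀ one_le_two (Finset.card_le_univ R)) hC0
  -- the family indexed by fine supports, with the constant moved into the empty index
  let K : ℝ := ∑ _v : Site 3 L, ∫ W, g W ∂(configMeasure G L')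
  let h : Finset (Edge 3 L) → GaugeConfig 3 L G → ℝ := fun F' U =>
    if F' = ∅ then K - c else ∑ v : Site 3 L, ∑ R ∈ univ.filter (fun R : Finset (Edge 3 L') => fineSupp L v R = F'), P v R U
  have hB : ∀ F' : Finset (Edge 3 L), ∀ U, |∑ v : Site 3 L, ∑ R ∈ univ.filter (fun R : Finset (Edge 3 L') => fineSupp L v R = F'), P v R U|
      ≤ ∑ _v : Site 3 L, ∑ _R : Finset (Edge 3 L'), 2 ^ Fintype.card (Edge 3 L') * C := by
    intro F' U
    refine (Finset.abs_sum_le_sum_abs _ _).trans (Finset.sum_le_sum fun v _ => ?_)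
    refine (Finset.abs_sum_le_sum_abs _ _).trans ((Finset.sum_le_sum fun R _ => hPb v R U).trans ?_)
    exact Finset.sum_le_sum_of_subset_of_nonneg (Finset.filter_subset _ _) fun R _ _ =>
      mul_nonneg (pow_nonneg zero_le_two _) ((abs_nonneg _).trans (hC (thin L' (torusConfigShift v U))))
  have hall : ∀ F', h F' =ᵐ[configMeasure G L] 0 := by
    refine ae_eq_zero_of_sum_parts (μ := η) h (fun F' => ?_) (fun F' => ?_) (fun F' => ?_) (fun F' => ?_) ?_
    · by_cases hF' : F' = ∅
      · simp only [h, hF', if_true]; exact measurable_const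
      · simp only [h, hF', if_false]
        exact Finset.measurable_sum _ fun v _ => Finset.measurable_sum _ fun R _ => hPm v R
    · by_cases hF' : F' = ∅
      · exact ⟨|K - c|, fun U => by simp only [h, hF', if_true]; exact le_rfl⟩
      · exact ⟨_, fun U => by simp only [h, hF', if_false]; exact hB F' U⟩
    · by_cases hF' : F' = ∅
      · intro U W _; simp only [h, hF', if_true]
      · intro U W hUW
        simp only [h, hF', if_false]
        refine Finset.sum_congr rfl fun v _ => Finset.sum_congr rfl fun R hR => ?_
        rw [Finset.mem_filter] at hR
        exact dependsOff_comp_thin_shift (dependsOff_esPart R g) v U W (hR.2 ▸ hUW)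
    · intro f hf
      have hF' : F' ≠ ∅ := Finset.ne_empty_of_mem hf
      refine Filter.Eventually.of_forall fun U => ?_
      have hfun : h F' = fun U => ∑ v : Site 3 L, ∑ R ∈ univ.filter (fun R : Finset (Edge 3 L') => fineSupp L v R = F'), P v R U := by
        funext U; simp only [h, hF', if_false]
      rw [hfun, condAvg_finset_sum _ _ _ (fun v _ => Finset.measurable_sum _ fun R _ => hPm v R)
        (fun v _ => ⟨∑ _R : Finset (Edge 3 L'), 2 ^ Fintype.card (Edge 3 L') * C, fun U =>
          (Finset.abs_sum_le_sum_abs _ _).trans ((Finset.sum_le_sum fun R _ => hPb v R U).trans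
            (Finset.sum_le_sum_of_subset_of_nonneg (Finset.filter_subset _ _) fun R _ _ =>
              mul_nonneg (pow_nonneg zero_le_two _) ((abs_nonneg _).trans (hC (thin L' (torusConfigShift v U))))))⟩)]
      refine Finset.sum_eq_zero fun v _ => ?_
      rw [condAvg_finset_sum _ _ _ (fun R _ => hPm v R) (fun R _ => ⟨_, hPb v R⟩)]
      refine Finset.sum_eq_zero fun R hR => ?_
      rw [Finset.mem_filter] at hR
      have hfR : f ∈ fineSupp L v R := hR.2 ▸ hf
      exact congrFun (condAvg_esPart_comp_thin_shift_eq_zero hLL hg hC R v hfR) U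
    · -- `Σ_F h_F = S g − c` pointwise, hence `= 0` a.e.
      have hsum : ∀ U, ∑ F' : Finset (Edge 3 L), h F' U = (∑ v : Site 3 L, g (thin L' (torusConfigShift v U))) - c := by
        intro U
        rw [← Finset.add_sum_erase _ _ (Finset.mem_univ (∅ : Finset (Edge 3 L)))]
        simp only [h, if_true]
        have hrest : ∑ F' ∈ (univ : Finset (Finset (Edge 3 L))).erase ∅,
            (if F' = ∅ then K - c else ∑ v : Site 3 L, ∑ R ∈ univ.filter (fun R : Finset (Edge 3 L') => fineSupp L v R = F'), P v R U) =
            ∑ F' ∈ (univ : Finset (Finset (Edge 3 L))).erase ∅,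
              ∑ v : Site 3 L, ∑ R ∈ univ.filter (fun R : Finset (Edge 3 L') => fineSupp L v R = F'), P v R U := by
          refine Finset.sum_congr rfl fun F' hF' => ?_
          rw [if_neg (Finset.ne_of_mem_erase hF')]
        rw [hrest]
        -- complete the sum over `F'` with the `∅`-fiber (`R = ∅` only) and regroup by `(v, R)`
        have hfib : ∀ v : Site 3 L, ∑ F' : Finset (Edge 3 L),
            ∑ R ∈ univ.filter (fun R : Finset (Edge 3 L') => fineSupp L v R = F'), P v R U = ∑ R : Finset (Edge 3 L'), P v R U :=
          fun v => Finset.sum_fiberwise univ (fun R : Finset (Edge 3 L') => fineSupp L v R) fun R => P v R U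
        have hempty : ∀ v : Site 3 L, ∑ R ∈ univ.filter (fun R : Finset (Edge 3 L') => fineSupp L v R = ∅), P v R U =
            ∫ W, g W ∂(configMeasure G L') := by
          intro v
          have : univ.filter (fun R : Finset (Edge 3 L') => fineSupp L v R = ∅) = {∅} := by
            ext R; simp [fineSupp_eq_empty_iff]
          rw [this, Finset.sum_singleton]
          change esPart η ∅ g _ = _
          rw [hη, esPart_empty]
        have htot : ∀ v : Site 3 L, ∑ R : Finset (Edge 3 L'), P v R U = g (thin L' (torusConfigShift v U)) :=
          fun v => sum_esPart (μ := η) g _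
        have key : ∑ F' ∈ (univ : Finset (Finset (Edge 3 L))).erase ∅,
            ∑ v : Site 3 L, ∑ R ∈ univ.filter (fun R : Finset (Edge 3 L') => fineSupp L v R = F'), P v R U =
            ∑ v : Site 3 L, (g (thin L' (torusConfigShift v U)) - ∫ W, g W ∂(configMeasure G L')) := by
          rw [Finset.sum_comm]
          refine Finset.sum_congr rfl fun v _ => ?_
          have h1 := hfib v
          rw [← Finset.add_sum_erase _ _ (Finset.mem_univ (∅ : Finset (Edge 3 L))), hempty v, htot v] at h1
          linarith
        rw [key, Finset.sum_sub_distrib]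
        simp only [K, Finset.sum_const, Finset.card_univ, nsmul_eq_mul]
        ring
      filter_upwards [hS] with U hU
      rw [hsum U, hU]
      simp
  have hne : F ≠ ∅ := Finset.nonempty_iff_ne_empty.1 hF
  have := hall F
  simp only [h, hne, if_false] at this
  exact this

end Summit.QuantumFields.YangMills.Theorems.FlatTubeReduction.Decimation
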